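import Summits.BirchSwinnertonDyer.BirchSwinnertonDyer.Theorems.GenusKolyvaginAtTwoMinimalTwinBSDTwoSwappedPairOneBitPrime
import Summits.BirchSwinnertonDyer.BirchSwinnertonDyer.Theorems.GenusKolyvaginAtTwoPowDvdShaCardAtTwoRTGenusParity
import Literature.NumberTheory.EllipticCurves.Greenberg1999.TwoTorsionDiscriminantConfigurationProofs
import HarnessLib

/-!
# Route `GenusKolyvaginAtTwo` (rev 57, after LINE 25 «s1_depth_zero»): the deciding theorem `closes` consumes the rank-one input
# U₂ `MinimalTwinBSDTwo` (stmt-BirchSwinnertonDyer-22985) on exactly two Tamagawa cells — RE-VALIDATED on the current `closes`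

Seat `bsd-line-gk2-p3` g28 (PROVER seat 3/3, cell `bsd-f1-sign2`), `--supports stmt-BirchSwinnertonDyer-22985` (helper; closes nothing).
THEOREMS ONLY (no definition, no named fact, no `sorry`); standard axioms.  **BSD is NOT proved by this file; U₂ / hTw0 / hTw1 are NOT
proved; no item is closed.**  §1 is CONDITIONAL on the route's items exactly like `closes` (rev 57), of which it is a copy with ONE binder
weakened — bookkeeping about what the route consumes.

WHY A NEW FILE.  This seat's rev-53 ledger (`…MinimalTwinBSDTwoTamagawaSlices`, p766209, and `…RouteLedgerOfReversedSupplies`, p767868)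
binds `(hOff : OffCutResidualAtTwo)`; the rev-57 route edit (LINE 25 adoption, 09:36Z) replaced that item by `OffCutResidualAtTwoR` and REMOVED
the old `def`, so those two modules no longer elaborate at HEAD and cannot be imported.  This file is SELF-CONTAINED (imports only healthy
modules), re-states the two twist-sign lemmas of p766209 §0 in its own namespace, and re-runs the sliced composition on rev 57.

WHAT CHANGED AT REV 54/57.  LINE 25 added two branches to `closes` (additive-only habitat curves with `#Sel₂(E) = 1`, both signs of `Δ`):
the supply is taken verbatim, `K1Neg` / `K1Pos` force `M₀ = 0`, `ShaVanishingAtDepthZeroAtTwo` gives `Ш(E/K)[2^∞] = 0`, and U₂ is applied to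
the supplied twin `Wd ≅ E^(d_K)` — `hTw Wd hcmd hrd hSel`, now at FOUR call sites.  At all four the twin lies on the same two cells as at rev 53:
`sign Δ(Wd) = sign Δ_E` (§0), on `Δ_E < 0` the supply's `ord₂ C(Wd) ≤ 1` and the genus parity law
(`PlusDescent.odd_padicValNat_two_tamagawaProduct_twin_of_Δ_neg`, UNCONDITIONAL: `C(E)` odd, `d_K` odd, Heegner ⟹ `ord₂ C(Wd)` odd) give
`ord₂ C(Wd) = 1`; on `Δ_E > 0` the supply gives `ord₂ C(Wd) = 0`.

* §0 `Δ_twin_neg_iff`, `Δ_twin_pos_iff` — `sign Δ(C • W^(d)) = sign Δ(W)` (`Δ` scales by `u⁻¹² d⁶`).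
* §1 **`nonCMAtTwo_of_items_of_tamagawaSlicedTwin_line25`** — `closes` (rev 57, 18 binders) with `hTw : MinimalTwinBSDTwo` REPLACED by the
  two cells `hTw0 = (0 < Δ_W, ord₂ C(W) = 0)` and `hTw1 = (Δ_W < 0, ord₂ C(W) = 1)`; every other binder (`hOff : OffCutResidualAtTwoR`, `hK1P`,
  `hK1N`, `hSha1` included) and every proof line verbatim (the converse bookkeeping U₂ ⟹ hTw0 ∧ hTw1 is `Slices.minimalTwinBSDTwo_slices`,
  p766209, statement-level trivial).
  So the NET TABLE of this seat's memo (`Cruxes/MinimalTwinBSDTwo/Lines/twin-swap-minus-gk2p3.md` v4) stands on rev 57: for the purpose of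
  `closes`, U₂ ≡ hTw0 + hTw1; the compositions `hTw0 ⟸ S1 + S2″ + PRINT`, `hTw1 ⟸ S1 + S2⁻′ + PRINT` feed it in the sibling file
  `…RouteLedgerLine25Supplies` (and the prime-frame / defect-2 variants in `…RouteLedgerLine25Prime`).

References: [Kramer1981] §2 Prop. 3; [GrossZagier1986] V.§2 (2.2); [Milne1972ArithmeticAV] §1 Thm. 1; [SilvermanAEC2009] III.1 Table 3.1;
[Miller2011LMS] Def. 1.1.
-/

set_option autoImplicit false
set_option linter.dupNamespace false -- `Summit.<P>.<Sub>` repeats `BirchSwinnertonDyer` (D-0017)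

noncomputable section

open scoped Classical

open WeierstrassCurve NumberField Literature.NumberTheory.EllipticCurves
  Literature.NumberTheory.EllipticCurves.ModularForms
  Summit.BirchSwinnertonDyer.BirchSwinnertonDyer.Rank1Residual
  Summit.BirchSwinnertonDyer.BirchSwinnertonDyer.Theses.GenusKolyvaginAtTwo
  Summit.BirchSwinnertonDyer.BirchSwinnertonDyer.Theorems.GenusExact.PlusDescent

namespace Summit.BirchSwinnertonDyer.BirchSwinnertonDyer.Theorems.GenusExact.TwinSwap.Ledger.Line25

/-! ## §0 Sign of the discriminant of a twin -/

/-- `sign Δ` of an elliptic `ℚ`-model of a quadratic twist equals `sign Δ` of the curve, negative side: `Δ(C • W^(d)) = u⁻¹² d⁶ Δ(W)`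
(re-stated here because the rev-53 module `…TamagawaSlices` carrying it no longer elaborates, see the header).
[cite: SilvermanAEC2009, III.1 Table 3.1] -/
theorem Δ_twin_neg_iff (W : WeierstrassCurve ℚ) {d : ℚ} (hd : d ≠ 0) {Wd : WeierstrassCurve ℚ} (Cd : VariableChange ℚ)
    (hCd : Cd • W.quadraticTwist d = Wd) : Wd.Δ < 0 ↔ W.Δ < 0 := by
  rw [← hCd, Literature.NumberTheory.EllipticCurves.Greenberg1999.Δ_smul_neg_iff, quadraticTwist_Δ]
  have h6 : (0 : ℚ) < d ^ 6 := Even.pow_pos (by decide) hd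
  constructor
  · intro h
    by_contra hW
    exact absurd h (not_lt.mpr (mul_nonneg h6.le (not_lt.mp hW)))
  · exact fun h ↦ mul_neg_of_pos_of_neg h6 h

/-- `sign Δ` of a twin, positive side. [cite: SilvermanAEC2009, III.1 Table 3.1] -/
theorem Δ_twin_pos_iff (W : WeierstrassCurve ℚ) {d : ℚ} (hd : d ≠ 0) {Wd : WeierstrassCurve ℚ} (Cd : VariableChange ℚ)
    (hCd : Cd • W.quadraticTwist d = Wd) : 0 < Wd.Δ ↔ 0 < W.Δ := by
  rw [← hCd, Literature.NumberTheory.EllipticCurves.Greenberg1999.Δ_smul_pos_iff, quadraticTwist_Δ]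
  have h6 : (0 : ℚ) < d ^ 6 := Even.pow_pos (by decide) hd
  constructor
  · intro h
    by_contra hW
    exact absurd h (not_lt.mpr (mul_nonpos_of_nonneg_of_nonpos h6.le (not_lt.mp hW)))
  · exact fun h ↦ mul_pos h6 h

/-! ## §1 `closes` (rev 57) with the rank-one input sliced by sign and Tamagawa valuation -/

/-- **THE ROUTE (rev 57) CONSUMES U₂ ON EXACTLY TWO TAMAGAWA CELLS.**  The deciding theorem `GenusKolyvaginAtTwo.closes` (rev 57, after
LINE 25) with its binder `hTw : MinimalTwinBSDTwo` REPLACED by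
`hTw0` — `BSD₂(W)` for non-CM globally minimal `W` of analytic rank `1` with `#Sel₂(W) = 2`, **`0 < Δ_W` and `ord₂ C(W) = 0`**, and
`hTw1` — the same with **`Δ_W < 0` and `ord₂ C(W) = 1`**;
all other binders (the two supply cruxes, Q1, Q2, Q5R, Q3R_T, Q4_T, the exact-descent glue, the two residuals with `OffCutResidualAtTwoR`,
`K1Pos`, `K1Neg`, `ShaVanishingAtDepthZeroAtTwo`, the four PRINT items) and every proof line VERBATIM from `closes`; at each of the four call
sites of `hTw` the twin `Wd` is put on its cell by `sign Δ(Wd) = sign Δ_E` and `ord₂ C(Wd) = 1` (supply `≤ 1` + genus parity) resp. `= 0`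
(supply).  CONDITIONAL on the route's items (as `closes` is); proves nothing about BSD by itself; closes no item.
[cite: Kramer1981, §2 Prop. 3] [cite: SilvermanAEC2009, III.1 Table 3.1] [cite: Miller2011LMS, Def. 1.1] -/
theorem nonCMAtTwo_of_items_of_tamagawaSlicedTwin_line25
    (hP : GenusPrimitiveSupplyAtTwoPosDiscShallow) (hPG : GenusDeepSupplyAtTwoNegDiscNarrow) (hQ1 : CyclicTorsionOfNegDisc)
    (hQ2 : KolyvaginRelationAtTwo)
    (hQ5R : EquivariantChebotarevAtTwoR) (hQ3RT : EquivariantKolyvaginExactAtTwoRT)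
    (hQ4T : KolyvaginExactAtTwoPosDiscT) (hGf : ExactDescentAtTwoOfFourFacts)
    (hR : OffHabitatResidualAtTwo) (hOff : OffCutResidualAtTwoR)
    (hK1P : K1Pos) (hK1N : K1Neg) (hSha1 : ShaVanishingAtDepthZeroAtTwo)
    (hTw0 : ∀ (W : WeierstrassCurve ℚ) [W.IsElliptic] [W.IsGloballyMinimal], ¬ W.HasCM → W.analyticRank = 1 →
      Nat.card (W.selmerGroup 2) = 2 → 0 < W.Δ → padicValNat 2 W.tamagawaProduct = 0 → BSDp W 2)
    (hTw1 : ∀ (W : WeierstrassCurve ℚ) [W.IsElliptic] [W.IsGloballyMinimal], ¬ W.HasCM → W.analyticRank = 1 →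
      Nat.card (W.selmerGroup 2) = 2 → W.Δ < 0 → padicValNat 2 W.tamagawaProduct = 1 → BSDp W 2)
    (hL : EntireLFunctionRat)
    (hGZ : GrossZagierAllLevels) (hGZK : MultPublishedInputsAtTwo) (hMi : MilneAnyModel) :
    NonCMAtTwo := by
  have hG : ExactDescentAtTwo := hGf ⟨hGZ, hGZK, hL, hMi⟩
  intro W _ _ hcm hr
  haveI : NeZero (W.conductorNorm ℤ) := ⟨(W.conductorNorm_pos_holds).ne'⟩
  by_cases hH : (W.analyticRank = 0 ∧ (∀ n : ℕ, 0 < n → W.HasSurjectiveModNGaloisRep ((2 : ℤ) ^ n)) ∧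
        Odd W.tamagawaProduct ∧
        ∃ Dt : Literature.NumberTheory.EllipticCurves.ModularForms.ModularParametrizationData W (W.conductorNorm ℤ),
          (∀ z ∈ Dt.L.lattice, ∃ w ∈ Literature.NumberTheory.EllipticCurves.ModularForms.periodLattice Dt.f, z = (Dt.c : ℂ) * w) ∧ Odd Dt.c)
  · obtain ⟨hr0, hρ, hT, hopt⟩ := hH
    -- an elliptic curve has `Δ ≠ 0`
    have hΔ : W.Δ ≠ 0 := by rw [← WeierstrassCurve.coe_Δ']; exact W.Δ'.ne_zero
    -- `w(E) = +1` from `r_an(E) = 0` (used on both signs)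
    have hw : ∀ Dt : Literature.NumberTheory.EllipticCurves.ModularForms.ModularParametrizationData W (W.conductorNorm ℤ),
        W.rootNumber = 1 := fun Dt ↦
      (Literature.Barriers.BirchSwinnertonDyer.even_analyticRank_iff_of_isNewformOf_conductorLevel Dt.isNewformOf).mp
        (by rw [hr0]; exact Even.zero)
    -- the two cells, once per sign: the consumed twin has `sign Δ(Wd) = sign Δ_E` and `ord₂ C(Wd) = 1` resp. `= 0`
    have hcell1 : W.Δ < 0 → ∀ (K : Type) [Field K] [NumberField K], IsImaginaryQuadratic K → Odd (NumberField.discr K) →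
        SatisfiesHeegnerHypothesis (W.conductorNorm ℤ) K → ∀ (Wd : WeierstrassCurve ℚ) [Wd.IsElliptic] [Wd.IsGloballyMinimal],
        (∃ C : VariableChange ℚ, C • W.quadraticTwist (NumberField.discr K : ℚ) = Wd) → ¬ Wd.HasCM → Wd.analyticRank = 1 →
        Nat.card (Wd.selmerGroup 2) = 2 → padicValNat 2 Wd.tamagawaProduct ≤ 1 → BSDp Wd 2 := by
      intro hneg K _ _ hIQ hodd hHe Wd _ _ hWd hcmd hrd hSel hDEF
      obtain ⟨Cd, hCd⟩ := hWd
      have hD0 : (NumberField.discr K : ℚ) ≠ 0 := by exact_mod_cast NumberField.discr_ne_zero K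
      have hΔd : Wd.Δ < 0 := (Δ_twin_neg_iff W hD0 Cd hCd).mpr hneg
      obtain ⟨k, hk⟩ := odd_padicValNat_two_tamagawaProduct_twin_of_Δ_neg W hIQ hodd hHe hT hneg Cd hCd
      have h1 : padicValNat 2 Wd.tamagawaProduct = 1 := by omega
      exact hTw1 Wd hcmd hrd hSel hΔd h1
    have hcell0 : 0 < W.Δ → ∀ (K : Type) [Field K] [NumberField K],
        ∀ (Wd : WeierstrassCurve ℚ) [Wd.IsElliptic] [Wd.IsGloballyMinimal],
        (∃ C : VariableChange ℚ, C • W.quadraticTwist (NumberField.discr K : ℚ) = Wd) → ¬ Wd.HasCM → Wd.analyticRank = 1 →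
        Nat.card (Wd.selmerGroup 2) = 2 → padicValNat 2 Wd.tamagawaProduct = 0 → BSDp Wd 2 := by
      intro hpos K _ _ Wd _ _ hWd hcmd hrd hSel hTam
      obtain ⟨Cd, hCd⟩ := hWd
      have hD0 : (NumberField.discr K : ℚ) ≠ 0 := by exact_mod_cast NumberField.discr_ne_zero K
      have hΔd : 0 < Wd.Δ := (Δ_twin_pos_iff W hD0 Cd hCd).mpr hpos
      exact hTw0 Wd hcmd hrd hSel hΔd hTam
    rcases lt_or_gt_of_ne hΔ with hneg | hpos
    · -- `Δ < 0`
      by_cases hmult : ∃ v : IsDedekindDomain.HeightOneSpectrum (NumberField.RingOfIntegers ℚ),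
          ((2 : ℕ) : NumberField.RingOfIntegers ℚ) ∉ v.asIdeal ∧
          ((W.conductorNorm ℤ : ℕ) : NumberField.RingOfIntegers ℚ) ∈ v.asIdeal ∧ W.HasMultiplicativeReductionAt v
      · by_cases h14 : Nat.card (W.selmerGroup 2) = 1 ∨ Nat.card (W.selmerGroup 2) = 4
        · obtain ⟨v, h2v, hNv, hmv⟩ := hmult
          obtain ⟨K, _, _, hIQ, hodd, h3, hHe, hsq1, hsq2, Dt, β, ι, d₁, hoptDt, hc, hy, M₀, hdiv, hndiv,
            n, d, hn, hKoly, hPn, Wd, _, _, hWd, hcmd, hrd, hSel, hDEF⟩ := hPG W hcm hr0 hρ hT hneg hopt h14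
          have hBd : Literature.NumberTheory.EllipticCurves.BSDp Wd 2 := hcell1 hneg K hIQ hodd hHe Wd hWd hcmd hrd hSel hDEF
          exact hG W hcm hr0 hρ hT K hIQ hodd h3 hHe Dt hoptDt hc β ι d₁ hy M₀ hdiv hndiv
            (hQ3RT hQ2 hQ5R hQ1 W hcm hT v h2v hNv hmv hneg K hIQ hodd h3 hHe hsq1 hsq2 hρ Dt β ι d₁ hy M₀ hdiv hndiv
              (hw Dt) Wd hWd hSel hDEF n d hn hKoly hPn)
            Wd hWd hSel hBd
        · exact hOff W hcm hr0 hρ hT hopt (Or.inr (Or.inl ⟨hneg, h14⟩))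
      · -- rev 54 (LINE 25 «s1_depth_zero»): additive-only at DEPTH ZERO — supply VERBATIM, K₁, v-free `Ш(E/K)[2^∞] = 0`
        by_cases h1 : Nat.card (W.selmerGroup 2) = 1
        · obtain ⟨K, _, _, hIQ, hodd, h3, hHe, hsq1, hsq2, Dt, β, ι, d₁, hoptDt, hc, hy, M₀, hdiv, hndiv,
            n, d, hn, hKoly, hPn, Wd, _, _, hWd, hcmd, hrd, hSel, hDEF⟩ := hPG W hcm hr0 hρ hT hneg hopt (Or.inl h1)
          have hM0 : M₀ = 0 := by
            by_contra hne
            exact hK1N W hcm hr0 hρ hT hneg h1 K hIQ hodd h3 hHe hsq1 hsq2 Dt hoptDt hc β ι d₁ hy M₀ hdiv hndiv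
              (Nat.one_le_iff_ne_zero.mpr hne) Wd hWd hrd hSel hDEF
          subst hM0
          have hSha : Nat.card (AddCommGroup.primaryComponent (W.baseChange K).sha 2) = 2 ^ (2 * 0) := by
            rw [mul_zero, pow_zero]
            exact hSha1 W K hT hr0 h1 hIQ hodd hHe (by simpa using hρ 1 one_pos) Dt β ι d₁ hy 0 hndiv Wd hWd hSel
              (Or.inl ⟨hneg, hDEF⟩)
          have hBd : Literature.NumberTheory.EllipticCurves.BSDp Wd 2 := hcell1 hneg K hIQ hodd hHe Wd hWd hcmd hrd hSel hDEF
          exact hG W hcm hr0 hρ hT K hIQ hodd h3 hHe Dt hoptDt hc β ι d₁ hy 0 hdiv hndiv hSha Wd hWd hSel hBd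
        · exact hOff W hcm hr0 hρ hT hopt (Or.inl ⟨hmult, h1⟩)
    · -- `Δ > 0`
      by_cases hmult : ∃ v : IsDedekindDomain.HeightOneSpectrum (NumberField.RingOfIntegers ℚ),
          ((2 : ℕ) : NumberField.RingOfIntegers ℚ) ∉ v.asIdeal ∧
          ((W.conductorNorm ℤ : ℕ) : NumberField.RingOfIntegers ℚ) ∈ v.asIdeal ∧ W.HasMultiplicativeReductionAt v
      · by_cases h14 : Nat.card (W.selmerGroup 2) = 1 ∨ (Nat.card (W.selmerGroup 2) = 4 ∧
            ∃ c ∈ (W.kummerSelmerStructure ((2 : ℕ) : ℤ)).selmerGroup,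
              Literature.NumberTheory.GaloisRepresentations.galoisCohomology.localization (W.torsionGaloisModule ((2 : ℕ) : ℤ))
                (Sum.inl Rat.infinitePlace) 1 c ≠ 0)
        · obtain ⟨v, h2v, hNv, hmv⟩ := hmult
          obtain ⟨K, _, _, hIQ, hodd, h3, hHe, hsq1, hsq2, Dt, β, ι, d₁, hoptDt, hc, hy, M₀, hdiv, hndiv,
            n, d, hn, hKoly, hPn, Wd, _, _, hWd, hcmd, hrd, hSel, hTam⟩ := hP W hcm hr0 hρ hT hpos hopt h14
          have hBd : Literature.NumberTheory.EllipticCurves.BSDp Wd 2 := hcell0 hpos K Wd hWd hcmd hrd hSel hTam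
          exact hG W hcm hr0 hρ hT K hIQ hodd h3 hHe Dt hoptDt hc β ι d₁ hy M₀ hdiv hndiv
            (hQ4T hQ2 W hcm hT v h2v hNv hmv hpos K hIQ hodd h3 hHe hsq1 hsq2 hρ Dt β ι d₁ hy M₀ hdiv hndiv (hw Dt) Wd hWd hSel hTam
              n d hn hKoly hPn)
            Wd hWd hSel hBd
        · exact hOff W hcm hr0 hρ hT hopt (Or.inr (Or.inr ⟨hpos, h14⟩))
      · -- rev 54 (LINE 25 «s1_depth_zero»): additive-only at DEPTH ZERO — supply VERBATIM, K₁⁺, v-free `Ш(E/K)[2^∞] = 0`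
        by_cases h1 : Nat.card (W.selmerGroup 2) = 1
        · obtain ⟨K, _, _, hIQ, hodd, h3, hHe, hsq1, hsq2, Dt, β, ι, d₁, hoptDt, hc, hy, M₀, hdiv, hndiv,
            n, d, hn, hKoly, hPn, Wd, _, _, hWd, hcmd, hrd, hSel, hDEF⟩ := hP W hcm hr0 hρ hT hpos hopt (Or.inl h1)
          have hM0 : M₀ = 0 := by
            by_contra hne
            exact hK1P W hcm hr0 hρ hT hpos h1 K hIQ hodd h3 hHe hsq1 hsq2 Dt hoptDt hc β ι d₁ hy M₀ hdiv hndiv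
              (Nat.one_le_iff_ne_zero.mpr hne) Wd hWd hrd hSel hDEF
          subst hM0
          have hSha : Nat.card (AddCommGroup.primaryComponent (W.baseChange K).sha 2) = 2 ^ (2 * 0) := by
            rw [mul_zero, pow_zero]
            exact hSha1 W K hT hr0 h1 hIQ hodd hHe (by simpa using hρ 1 one_pos) Dt β ι d₁ hy 0 hndiv Wd hWd hSel
              (Or.inr ⟨hpos, hDEF⟩)
          have hBd : Literature.NumberTheory.EllipticCurves.BSDp Wd 2 := hcell0 hpos K Wd hWd hcmd hrd hSel hDEF
          exact hG W hcm hr0 hρ hT K hIQ hodd h3 hHe Dt hoptDt hc β ι d₁ hy 0 hdiv hndiv hSha Wd hWd hSel hBd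
        · exact hOff W hcm hr0 hρ hT hopt (Or.inl ⟨hmult, h1⟩)
  · exact hR W hcm hr hH

end Summit.BirchSwinnertonDyer.BirchSwinnertonDyer.Theorems.GenusExact.TwinSwap.Ledger.Line25

end
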